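import Mathlib
import Summits.Ventures.HodgeRepro.LitRankYanai1

/-!
# LitRankYanai2 — `H C = G`, rank ≥ 3 for simple types, right translates, simplicity on the cyclic transversal

Blind cell `pub-hodge-repro`, seat lit-2. Part 2 of 4 of the former single file `LitRankYanai.lean` (split at the ≤ 400-line rule, gen 4; text of every declaration unchanged). Imports `LitRankYanai1` (and through it the rest of the chain).
-/

open Finset
open scoped Pointwise

namespace HodgeRepro.Lit2

/-! ## §3–4  H C = G; rank ≥ 3 for simple types; right translates -/

namespace CMTriple

variable {G : Type*} [Group G] [Fintype G] [DecidableEq G] (T : CMTriple G)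

/-! ### `H C = G` for a subgroup `C` with `C ∩ H = 1` and `|C| = [G : H]` -/

omit [DecidableEq G] in
/-- A subgroup `C` with `C ⊓ H = ⊥` and `Nat.card C = H.index` meets every right coset: every
`x ∈ G` is `h * c`. -/
theorem exists_mul_eq_of_inf_eq_bot (C : Subgroup G) (hCH : C ⊓ T.H = ⊥)
    (hcard : Nat.card C = T.H.index) : ∀ x : G, ∃ h ∈ T.H, ∃ c ∈ C, x = h * c := by
  classical
  -- the multiplication map `H × C → G` is injective, hence bijective by cardinality
  let f : T.H × C → G := fun p => (p.1 : G) * p.2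
  have hinj : Function.Injective f := by
    rintro ⟨h, c⟩ ⟨h', c'⟩ heq
    simp only [f] at heq
    have this : ((h' : G)⁻¹ * h : G) = (c' : G) * (c : G)⁻¹ := by
      rw [eq_mul_inv_iff_mul_eq, mul_assoc, heq, inv_mul_cancel_left]
    have hmem : ((h' : G)⁻¹ * h : G) ∈ C ⊓ T.H := by
      rw [Subgroup.mem_inf]
      exact ⟨this ▸ C.mul_mem c'.2 (C.inv_mem c.2), T.H.mul_mem (T.H.inv_mem h'.2) h.2⟩
    rw [hCH, Subgroup.mem_bot, inv_mul_eq_one] at hmem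
    have hc : (c' : G) * (c : G)⁻¹ = 1 := by rw [← this, hmem, inv_mul_cancel]
    rw [mul_inv_eq_one] at hc
    exact Prod.ext (Subtype.ext hmem.symm) (Subtype.ext hc.symm)
  have hcardHC : Nat.card (T.H × C) = Nat.card G := by
    rw [Nat.card_prod, hcard, Subgroup.card_mul_index]
  have hsurj : Function.Surjective f := by
    haveI : Finite (T.H × C) := inferInstance
    exact (Nat.bijective_iff_injective_and_card f).mpr ⟨hinj, hcardHC⟩ |>.2
  intro x
  obtain ⟨⟨h, c⟩, hx⟩ := hsurj x
  exact ⟨h, h.2, c, c.2, hx.symm⟩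

/-! ### The right translate: same `H`, same simplicity -/

omit [Fintype G] in
/-- The right translate keeps `H`. -/
theorem rightTranslate_H (g : G) : (T.rightTranslate g).H = T.H := rfl

omit [Fintype G] in
/-- The right translate keeps `ρ`. -/
theorem rightTranslate_ρ (g : G) : (T.rightTranslate g).ρ = T.ρ := rfl

omit [Fintype G] in
/-- The right translate has `S̃ g` as its type. -/
theorem rightTranslate_S (g : G) : (T.rightTranslate g).S = T.S.image (· * g) := rfl

omit [Fintype G] in
/-- The right translate has the same dimension. -/
theorem dim_rightTranslate (g : G) : (T.rightTranslate g).dim = T.dim := rfl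

omit [Fintype G] in
/-- `x (S̃ g) = (x S̃) g`. -/
theorem smul_image_mul_right (x g : G) : x • (T.S.image (· * g)) = (x • T.S).image (· * g) := by
  ext y
  simp only [Finset.mem_smul_finset, Finset.mem_image, smul_eq_mul]
  constructor
  · rintro ⟨_, ⟨s, hs, rfl⟩, rfl⟩
    exact ⟨x * s, ⟨s, hs, rfl⟩, by rw [mul_assoc]⟩
  · rintro ⟨_, ⟨s, hs, rfl⟩, rfl⟩
    exact ⟨s * g, ⟨s, hs, rfl⟩, by rw [mul_assoc]⟩

omit [Fintype G] in
/-- The right translate of a simple type is simple (same stabiliser). -/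
theorem isSimple_rightTranslate (g : G) (hs : T.IsSimple) : (T.rightTranslate g).IsSimple := by
  intro x hx
  rw [rightTranslate_H]
  apply hs x
  rw [rightTranslate_S, T.smul_image_mul_right] at hx
  exact Finset.image_injective (mul_left_injective g) hx

/-! ### `rank ≥ 3` for simple types with `d ≥ 2` -/

omit [Fintype G] in
/-- Exactly one of `1`, `ρ` lies in `S̃`; so both `S̃` and its complement are non-empty. -/
theorem one_mem_or_ρ_mem : (1 ∈ T.S ∧ T.ρ ∉ T.S) ∨ (1 ∉ T.S ∧ T.ρ ∈ T.S) := by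
  have h := T.mem_iff 1
  rw [one_mul] at h
  by_cases h1 : 1 ∈ T.S
  · exact Or.inl ⟨h1, h.mp h1⟩
  · exact Or.inr ⟨h1, by by_contra hρ; exact h1 (h.mpr hρ)⟩

omit [Group G] [Fintype G] in
/-- `𝟙_S x = 1 ↔ x ∈ S`. -/
theorem indFun_eq_one_iff (S : Finset G) (x : G) : indFun S x = 1 ↔ x ∈ S := by
  simp only [indFun]; split_ifs with h <;> simp [h]

/-- Kubota's rank through the indicator vectors of the left translates `g S̃`. -/
theorem rank_eq_finrank_span_indFun_smul :
    T.rank = Module.finrank ℚ (Submodule.span ℚ (Set.range fun g : G => indFun (g • T.S))) := by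
  rw [rank_eq_rank_leftMat, Matrix.rank_eq_finrank_span_cols]
  have hc : T.leftMat.col = fun g : G => indFun (g • T.S) := funext T.leftMat_col
  rw [hc]

/-- **`rank ≥ 3` for a simple type with `d ≥ 2`** (the elementary half of Ribet's bound
`rank ≥ 2 + log₂ d`): if the translates `g S̃` spanned a plane, that plane would be
`⟨𝟙_{S̃}, 𝟙_{S̃ᶜ}⟩`, whose only `0/1`-vectors of weight `|S̃|` are `𝟙_{S̃}` and `𝟙_{S̃ᶜ}`; so every
translate would be `S̃` or `ρ S̃`, i.e. `G = H ∪ ρ H` and `[G : H] ≤ 2`. -/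
theorem three_le_rank_of_isSimple (hs : T.IsSimple) (hd : 2 ≤ T.dim) : 3 ≤ T.rank := by
  classical
  by_contra hlt
  have hrank : T.rank ≤ 2 := by omega
  rw [T.rank_eq_finrank_span_indFun_smul] at hrank
  set u : G → ℚ := indFun T.S with hu
  set v : G → ℚ := indFun T.Sᶜ with hv
  -- the two vectors lie in the span of the translates
  set V := Submodule.span ℚ (Set.range fun g : G => indFun (g • T.S)) with hV
  have huV : u ∈ V := Submodule.subset_span ⟨1, by
    show indFun ((1 : G) • T.S) = u
    rw [one_smul]⟩
  have hvV : v ∈ V := Submodule.subset_span ⟨T.ρ, by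
    show indFun (T.ρ • T.S) = v
    rw [T.smul_S_eq_compl]⟩
  -- pointwise evaluation of `a • u + b • v`
  have heval : ∀ (a b : ℚ) (x : G), (a • u + b • v) x = if x ∈ T.S then a else b := by
    intro a b x
    simp only [Pi.add_apply, Pi.smul_apply, hu, hv, indFun, Finset.mem_compl, smul_eq_mul]
    split_ifs <;> simp
  -- `u, v` are linearly independent
  have hli : LinearIndependent ℚ ![u, v] := by
    rw [LinearIndependent.pair_iff]
    intro a b hab
    rcases T.one_mem_or_ρ_mem with ⟨h1, hρ⟩ | ⟨h1, hρ⟩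
    · have e1 := congrFun hab 1
      have e2 := congrFun hab T.ρ
      rw [heval, if_pos h1] at e1
      rw [heval, if_neg hρ] at e2
      exact ⟨e1, e2⟩
    · have e1 := congrFun hab 1
      have e2 := congrFun hab T.ρ
      rw [heval, if_neg h1] at e1
      rw [heval, if_pos hρ] at e2
      exact ⟨e2, e1⟩
  have hW : Submodule.span ℚ (Set.range ![u, v]) ≤ V := by
    rw [Submodule.span_le]
    rintro _ ⟨i, rfl⟩
    fin_cases i
    · exact huV
    · exact hvV
  have hdim2 : Module.finrank ℚ (Submodule.span ℚ (Set.range ![u, v])) = 2 := by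
    rw [finrank_span_eq_card hli, Fintype.card_fin]
  have hVeq : Submodule.span ℚ (Set.range ![u, v]) = V :=
    Submodule.eq_of_le_of_finrank_eq hW (by
      have := Submodule.finrank_mono hW
      omega)
  -- every translate is `S̃` or `S̃ᶜ`
  have htrans : ∀ g : G, g • T.S = T.S ∨ g • T.S = T.Sᶜ := by
    intro g
    have hg : indFun (g • T.S) ∈ Submodule.span ℚ (Set.range ![u, v]) := by
      rw [hVeq]; exact Submodule.subset_span ⟨g, rfl⟩
    rw [Submodule.mem_span_range_iff_exists_fun] at hg
    obtain ⟨c, hc⟩ := hg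
    rw [Fin.sum_univ_two] at hc
    simp only [Matrix.cons_val_zero, Matrix.cons_val_one] at hc
    -- the values `a := c 0`, `b := c 1` are `0` or `1`
    have hval : ∀ x, indFun (g • T.S) x = if x ∈ T.S then c 0 else c 1 := by
      intro x; rw [← hc, heval]
    have hmem : ∀ x, x ∈ g • T.S ↔ (if x ∈ T.S then c 0 else c 1) = 1 := by
      intro x; rw [← hval, indFun_eq_one_iff]
    have h01 : ∀ x, indFun (g • T.S) x = 0 ∨ indFun (g • T.S) x = 1 := by
      intro x; simp only [indFun]; split_ifs <;> simp
    obtain ⟨x₀, hx₀, x₁, hx₁⟩ : ∃ x₀ ∈ T.S, ∃ x₁, x₁ ∉ T.S := by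
      rcases T.one_mem_or_ρ_mem with ⟨h1, hρ⟩ | ⟨h1, hρ⟩
      · exact ⟨1, h1, T.ρ, hρ⟩
      · exact ⟨T.ρ, hρ, 1, h1⟩
    have hc0 : c 0 = 0 ∨ c 0 = 1 := by
      have := h01 x₀; rwa [hval, if_pos hx₀] at this
    have hc1 : c 1 = 0 ∨ c 1 = 1 := by
      have := h01 x₁; rwa [hval, if_neg hx₁] at this
    have hpos : 0 < T.S.card := Finset.card_pos.mpr ⟨x₀, hx₀⟩
    have hcard := Finset.card_smul_finset g T.S
    have h2 := T.two_mul_card_S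
    rcases hc0 with ha | ha <;> rcases hc1 with hb | hb <;> simp only [ha, hb] at hmem
    · -- `g S̃ = ∅`
      exfalso
      have : g • T.S = ∅ := Finset.eq_empty_iff_forall_notMem.mpr (fun x hx => by
        have := (hmem x).mp hx
        split_ifs at this <;> simp at this)
      rw [this, Finset.card_empty] at hcard
      omega
    · right
      ext x
      rw [hmem, Finset.mem_compl]
      split_ifs with hx <;> simp [hx]
    · left
      ext x
      rw [hmem]
      split_ifs with hx <;> simp [hx]
    · -- `g S̃ = G`
      exfalso
      have : g • T.S = Finset.univ := Finset.eq_univ_iff_forall.mpr (fun x => by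
        rw [hmem]; split_ifs <;> rfl)
      rw [this, Finset.card_univ] at hcard
      have hlt : T.S.card < Fintype.card G := by
        have : T.Sᶜ.card = Fintype.card G - T.S.card := Finset.card_compl T.S
        have hne : T.Sᶜ.Nonempty := ⟨x₁, Finset.mem_compl.mpr hx₁⟩
        have := Finset.card_pos.mpr hne
        omega
      omega
  -- hence `G = H ∪ ρ H`, so `[G : H] ≤ 2`
  have hcoset : ∀ g : G, (g : G ⧸ T.H) = ((1 : G) : G ⧸ T.H) ∨ (g : G ⧸ T.H) = (T.ρ : G ⧸ T.H) := by
    intro g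
    rcases htrans g with h | h
    · left
      rw [QuotientGroup.eq]
      simpa using T.H.inv_mem (hs g h)
    · right
      rw [QuotientGroup.eq]
      apply hs
      rw [mul_smul, T.smul_S_eq_compl, ← h, inv_smul_smul]
  have hidx : T.H.index ≤ 2 := by
    rw [Subgroup.index_eq_card, Nat.card_eq_fintype_card, ← Finset.card_univ]
    have hsub : (Finset.univ : Finset (G ⧸ T.H)) ⊆ {((1 : G) : G ⧸ T.H), (T.ρ : G ⧸ T.H)} := by
      intro q _
      induction q using QuotientGroup.induction_on with
      | H g =>
        rcases hcoset g with h | h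
        · rw [h]; exact Finset.mem_insert_self _ _
        · rw [h]; exact Finset.mem_insert_of_mem (Finset.mem_singleton_self _)
    exact (Finset.card_le_card hsub).trans (Finset.card_le_two)
  have := T.index_eq_two_mul_dim
  omega

end CMTriple

/-! ## §4  Simplicity on the cyclic transversal -/

namespace CMTriple

/-! ### Simplicity of a type on a cyclic group `⟨ρ γ⟩` of order `2d`, `d` an odd prime -/

section CyclicSimple

variable {K : Type*} [Group K] [Fintype K] [DecidableEq K] (U : CMTriple K)

omit [Fintype K] in
/-- The stabiliser of `S̃` is a subgroup: `c • S̃ = S̃` propagates to powers. -/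
theorem pow_smul_S_eq {c : K} (hc : c • U.S = U.S) (k : ℕ) : c ^ k • U.S = U.S := by
  induction k with
  | zero => rw [pow_zero, one_smul]
  | succ n ih => rw [pow_succ, mul_smul, hc, ih]

/-- `ρ` never stabilises `S̃`. -/
theorem ρ_smul_S_ne : U.ρ • U.S ≠ U.S := by
  intro h
  rw [U.smul_S_eq_compl] at h
  rcases U.one_mem_or_ρ_mem with ⟨h1, _⟩ | ⟨h1, _⟩
  · have : (1 : K) ∈ U.Sᶜ := by rw [h]; exact h1
    exact (Finset.mem_compl.mp this) h1
  · have : (1 : K) ∈ U.Sᶜ := Finset.mem_compl.mpr h1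
    rw [h] at this
    exact h1 this

/-- **Simplicity criterion on `⟨ρ γ⟩`** (`U.H = 1`, `γ` of odd prime order `d`, every element of
`K` a power of `ρ γ`): if `γ` does not stabilise `S̃`, the type is simple. -/
theorem isSimple_of_not_smul_eq (hH : U.H = ⊥) {γ : K} {d : ℕ} (hd : d.Prime) (hd2 : d ≠ 2)
    (hγ : orderOf γ = d) (hgen : ∀ c : K, c ∈ Subgroup.zpowers (U.ρ * γ))
    (hne : ¬ γ • U.S = U.S) : U.IsSimple := by
  intro c hc
  rw [hH, Subgroup.mem_bot]
  have hcz := hgen c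
  rw [← mem_powers_iff_mem_zpowers, Submonoid.mem_powers_iff] at hcz
  obtain ⟨k, rfl⟩ := hcz
  rw [(U.commute_ρ γ).mul_pow] at hc ⊢
  -- the square of `c` is `γ ^ (2k)`
  have hsq : (U.ρ ^ k * γ ^ k) ^ 2 • U.S = U.S := U.pow_smul_S_eq hc 2
  have hsq' : (U.ρ ^ k * γ ^ k) ^ 2 = γ ^ (2 * k) := by
    rw [((U.commute_ρ γ).pow_pow k k).mul_pow, ← pow_mul, ← pow_mul, mul_comm k 2,
      U.ρ_pow_even (even_two_mul k), one_mul]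
  rw [hsq'] at hsq
  -- `d ∣ k`, else `γ` is a power of `γ ^ (2k)` and stabilises `S̃`
  have hdk : d ∣ k := by
    by_contra hndk
    apply hne
    have hcop : (orderOf γ).Coprime (2 * k) := by
      rw [hγ]
      refine Nat.Coprime.mul_right ((Nat.coprime_primes hd Nat.prime_two).mpr hd2) ?_
      exact (Nat.Prime.coprime_iff_not_dvd hd).mpr hndk
    have hle : Subgroup.zpowers (γ ^ (2 * k)) ≤ Subgroup.zpowers γ :=
      Subgroup.zpowers_le.mpr (Subgroup.npow_mem_zpowers γ _)
    have heq : Subgroup.zpowers (γ ^ (2 * k)) = Subgroup.zpowers γ :=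
      Subgroup.eq_of_le_of_card_ge hle
        (by rw [Nat.card_zpowers, Nat.card_zpowers, hcop.orderOf_pow])
    have hγmem : γ ∈ Subgroup.zpowers (γ ^ (2 * k)) := heq ▸ Subgroup.mem_zpowers γ
    rw [← mem_powers_iff_mem_zpowers, Submonoid.mem_powers_iff] at hγmem
    obtain ⟨m, hm⟩ := hγmem
    rw [← hm]
    exact U.pow_smul_S_eq hsq m
  have hγk : γ ^ k = 1 := by rw [← orderOf_dvd_iff_pow_eq_one, hγ]; exact hdk
  rw [hγk, mul_one] at hc ⊢
  rcases Nat.even_or_odd k with hk | hk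
  · exact U.ρ_pow_even hk
  · exfalso
    rw [U.ρ_pow_odd hk] at hc
    exact U.ρ_smul_S_ne hc

/-- The `⟨γ⟩`-stable types on `⟨ρ γ⟩`: a subset `S̃` with `γ S̃ = S̃` is `⟨γ⟩` or `ρ ⟨γ⟩`. -/
theorem S_eq_zpowers_or_of_smul_eq {γ : K} {d : ℕ} (hγ : orderOf γ = d)
    (hcard : Fintype.card K = 2 * d) (hst : γ • U.S = U.S) :
    U.S = (univ : Finset K).filter (· ∈ Subgroup.zpowers γ) ∨
      U.S = U.ρ • (univ : Finset K).filter (· ∈ Subgroup.zpowers γ) := by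
  classical
  -- `|⟨γ⟩| = d = |S̃|`
  have hcardP : ((univ : Finset K).filter (· ∈ Subgroup.zpowers γ)).card = d := by
    rw [← hγ, ← Nat.card_zpowers, Nat.card_eq_fintype_card, Fintype.card_subtype]
  have hcardS : U.S.card = d := by
    have := U.two_mul_card_S; omega
  -- `S̃` contains every `γ ^ k • x` for `x ∈ S̃`
  have hstab : ∀ (x : K), x ∈ U.S → ∀ k : ℕ, γ ^ k * x ∈ U.S := by
    intro x hx k
    have := U.pow_smul_S_eq hst k
    rw [← this]
    exact Finset.smul_mem_smul_finset hx
  rcases U.one_mem_or_ρ_mem with ⟨h1, _⟩ | ⟨h1, hρ⟩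
  · left
    symm
    apply Finset.eq_of_subset_of_card_le
    · intro x hx
      rw [Finset.mem_filter] at hx
      obtain ⟨_, hx⟩ := hx
      rw [← mem_powers_iff_mem_zpowers, Submonoid.mem_powers_iff] at hx
      obtain ⟨k, rfl⟩ := hx
      simpa using hstab 1 h1 k
    · rw [hcardP, hcardS]
  · right
    symm
    apply Finset.eq_of_subset_of_card_le
    · intro x hx
      rw [Finset.mem_smul_finset] at hx
      obtain ⟨y, hy, rfl⟩ := hx
      rw [Finset.mem_filter] at hy
      obtain ⟨_, hy⟩ := hy
      rw [← mem_powers_iff_mem_zpowers, Submonoid.mem_powers_iff] at hy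
      obtain ⟨k, rfl⟩ := hy
      have := hstab U.ρ hρ k
      rw [smul_eq_mul, (U.commute_ρ γ).pow_right k |>.eq]
      exact this
    · rw [Finset.card_smul_finset, hcardP, hcardS]

end CyclicSimple

/-! ### Saturated subsets are determined by their trace on a transversal -/

variable {G : Type*} [Group G] [Fintype G] [DecidableEq G] (T : CMTriple G)

omit [Fintype G] [DecidableEq G] in
/-- An `H`-saturated finset `X` (`h x ∈ X` for `h ∈ H`, `x ∈ X`) is determined by `X ∩ C` when
`H C = G`. -/
theorem eq_of_inter_eq (C : Subgroup G) (hHC : ∀ x : G, ∃ h ∈ T.H, ∃ c ∈ C, x = h * c)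
    {X Y : Finset G} (hX : ∀ h ∈ T.H, ∀ x ∈ X, h * x ∈ X) (hY : ∀ h ∈ T.H, ∀ y ∈ Y, h * y ∈ Y)
    (hXY : ∀ c ∈ C, c ∈ X ↔ c ∈ Y) : X = Y := by
  have key : ∀ (Z : Finset G), (∀ h ∈ T.H, ∀ z ∈ Z, h * z ∈ Z) → ∀ x,
      x ∈ Z ↔ ∃ h ∈ T.H, ∃ c ∈ C, c ∈ Z ∧ x = h * c := by
    intro Z hZ x
    constructor
    · intro hx
      obtain ⟨h, hh, c, hc, rfl⟩ := hHC x
      refine ⟨h, hh, c, hc, ?_, rfl⟩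
      have := hZ h⁻¹ (T.H.inv_mem hh) _ hx
      rwa [inv_mul_cancel_left] at this
    · rintro ⟨h, hh, c, _, hc, rfl⟩
      exact hZ h hh c hc
  ext x
  rw [key X hX, key Y hY]
  constructor
  · rintro ⟨h, hh, c, hc, hcX, rfl⟩
    exact ⟨h, hh, c, hc, (hXY c hc).mp hcX, rfl⟩
  · rintro ⟨h, hh, c, hc, hcY, rfl⟩
    exact ⟨h, hh, c, hc, (hXY c hc).mpr hcY, rfl⟩

end CMTriple

end HodgeRepro.Lit2
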